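import Summits.NavierStokesRegularity.NavierStokesRegularity.Theses.AxisymmetricExtremality
import Literature.Analysis.FluidPDE.RusinSverakSingularPoint
import Literature.Analysis.FluidPDE.AxisymmetricTypeIBounded
import Literature.Analysis.FluidPDE.SereginSverakAxisymmetric
import Literature.Analysis.FluidPDE.Seregin2020SingularSetAxis
import Literature.Analysis.FluidPDE.AxisymmetricTypeIOffAxis
import Literature.Analysis.FluidPDE.SereginEpsilonRegularityHolds
import Literature.Analysis.FluidPDE.LocalTypeI
import Literature.Analysis.FluidPDE.SuitableWeakRescaling
import Literature.Analysis.FluidPDE.SereginSverakBlowupSelection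
import Literature.Analysis.FluidPDE.ClassicalSuitable
import Literature.Analysis.FluidPDE.KatoLocalCovariance
import HarnessLib

/-!
# Crux `AxisymmetricKatoGlobal` (stmt-NavierStokesRegularity-15453), line `registered`:
# stub `stub_offAxisBounded_of_localEnergy` — off the axis the final time is regular

Helper file of the line `registered` of the crux
`Summit.NavierStokesRegularity.NavierStokesRegularity.Theses.AxisymmetricExtremality.AxisymmetricKatoGlobal`
(lands `--supports stmt-NavierStokesRegularity-15453`): the registered stub 2b'
`stub_offAxisBounded_of_localEnergy`, verbatim.  For a suitable weak solution `(u, p)` of the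
unforced Navier–Stokes equations (viscosity `ν > 0`) on the open strip `(0, T) × ℝ³`, `u` smooth
there with axisymmetric slices, whose local energy classes reach the final time on every
`(t₁, T) × B_ρ(0)`, the field `u` is bounded on a backward parabolic neighbourhood of `(T, x₀)`
for every `x₀` OFF the axis (`IsBoundedNearTop u T x₀`).

The argument is the tree's `axisymmetricL3_boundedNearTop_offAxis_of_seregin` /
`Seregin2020.offAxis_regular` (Seregin–Šverák 2009, §3, arXiv:0804.1803 p. 9; Seregin 2020,
proof of Thm. 2.1, arXiv:2006.04140 p. 5; Caffarelli–Kohn–Nirenberg 1982) re-run for these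
hypotheses.  With `ρ₀ = |x₀'| > 0` and `ϱ = ‖x₀‖ + ρ₀`, the cut-off dissipation density
`F = 𝟙_{(T/2,T) × B(0,ϱ)} |∇u|²` is rotation invariant and of finite integral, so the rotation
packing `setLIntegral_prod_ball_le_of_rot_invariant` gives `∫_{I × B(x₀,r)} F ≤ (r/ρ₀) ∫_{I × ℝ³} F`
(`r ≤ ρ₀`), while the time tails `∫_{(T-τ,T) × ℝ³} F → 0`.  After the viscosity-normalising
rescaling `v = (R/ν) u ∘ Φ`, `π = (R/ν)² p ∘ Φ`, `Φ(s, y) = (T + (R²/ν) s, x₀ + R y)`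
(`IsSuitableWeakSolutionOn.stRescale`) the pair `(v, π)` is in Albritton–Barker's class
`IsSuitableWeakSolutionInBall 1 0` (the global classes on `Q(0,1)` come from the hypotheses on
`(T/2, T) × B(0, ϱ)` by the change of variables; the weak gradient of the smooth `u` is `fderiv`)
with `sup_{0<r<1} r⁻¹ ∫_{Q(0,r)} |∇v|² ≤ D(τ₀)/(ν ρ₀) < ε`; Seregin's backward ε-regularity
criterion (Seregin 2014, Ch. 6, Thm. 1.4, proved in the tree: `seregin2014_thm14_holds`) bounds
`v` essentially on some `Q(0, ϱ')`, i.e. `u` essentially on a `ν`-cylinder at `(T, x₀)`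
(`eLpNorm_top_comp_stAffine_restrict_preimage`), and for the continuous `u` this is a bound
(`SereginSverak2009.forall_le_of_ae_le_of_continuousOn`).  No named fact is used.
-/

-- the problem directory repeats the summit name (D-0017); core's `dupNamespace` linter fires
set_option linter.dupNamespace false

noncomputable section

open Set MeasureTheory Filter Topology TopologicalSpace Function Metric Module
open scoped ENNReal NNReal
open Literature.Analysis.FluidPDE Literature.Analysis.FunctionSpaces

namespace Summit.NavierStokesRegularity.NavierStokesRegularity.Theorems.AxisymmetricKatoGlobal.Registered

local notation "ℝ³" => EuclideanSpace ℝ (Fin 3)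

/-! ### Tools: from an essential bound to a bound, time tails, rotation invariance -/

/-- **An essential bound below `T` is a bound near `(T, x₀)`.** If `u` is continuous on
`(0, T) × ℝ³` and essentially bounded on the cylinder `(T - τ, T) × B(x₀, ρ)`, `0 < τ ≤ T`,
`ρ > 0`, then `u` is bounded on a backward parabolic neighbourhood of `(T, x₀)` (an a.e. bound of
a continuous function on an open set holds everywhere). -/
theorem isBoundedNearTop_of_eLpNorm_cylinder_lt_top {u : ℝ → ℝ³ → ℝ³} {T τ ρ : ℝ} {x₀ : ℝ³}
    (hcont : ContinuousOn (uncurry u) (Ioo 0 T ×ˢ univ)) (hτ : 0 < τ) (hτT : τ ≤ T) (hρ : 0 < ρ)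
    (hbd : eLpNorm (uncurry u) ∞ (volume.restrict (Ioo (T - τ) T ×ˢ ball x₀ ρ)) < ∞) :
    IsBoundedNearTop u T x₀ := by
  set S : Set (ℝ × ℝ³) := Ioo (T - τ) T ×ˢ ball x₀ ρ with hS
  set M : ℝ := (eLpNorm (uncurry u) ∞ (volume.restrict S)).toReal with hM
  have hae : ∀ᵐ z ∂(volume.restrict S), ‖uncurry u z‖ ≤ M := by
    filter_upwards [ae_le_eLpNormEssSup (μ := volume.restrict S) (f := uncurry u)] with z hz
    rw [← eLpNorm_exponent_top] at hz
    rw [hM, ← ENNReal.ofReal_le_iff_le_toReal hbd.ne, ofReal_norm]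
    exact hz
  have hSslab : S ⊆ Ioo 0 T ×ˢ (univ : Set ℝ³) :=
    prod_mono (Ioo_subset_Ioo_left (by linarith)) (subset_univ _)
  have hall := SereginSverak2009.forall_le_of_ae_le_of_continuousOn (isOpen_Ioo.prod isOpen_ball)
    (hcont.mono hSslab).norm continuousOn_const hae
  set r' : ℝ := min ρ (Real.sqrt τ) with hr'
  have hr'pos : 0 < r' := lt_min hρ (Real.sqrt_pos.2 hτ)
  have hr'τ : r' ^ 2 ≤ τ := by
    have h := pow_le_pow_left₀ hr'pos.le (min_le_right ρ (Real.sqrt τ)) 2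
    rwa [Real.sq_sqrt hτ.le] at h
  exact ⟨r', hr'pos, M, fun t ht x hx =>
    hall (t, x) ⟨⟨by linarith [ht.1], ht.2⟩, ball_subset_ball (min_le_left _ _) hx⟩⟩

/-- **Vanishing time tails of a finite space–time integral**: if `∫ F < ∞` on `ℝ × ℝ³`, then for
every `δ > 0` there is `0 < τ ≤ T` with `∫_{(T-τ, T) × ℝ³} F < δ` (continuity from above of the
finite measure with density `F` along `(T - T/(n+1), T) × ℝ³ ↓ ∅`). -/
theorem exists_time_tail_lt_of_lintegral_ne_top {F : ℝ × ℝ³ → ℝ≥0∞} (hF : ∫⁻ z, F z ≠ ∞)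
    {T : ℝ} (hT : 0 < T) {δ : ℝ≥0∞} (hδ : 0 < δ) :
    ∃ τ : ℝ, 0 < τ ∧ τ ≤ T ∧ ∫⁻ z in Ioo (T - τ) T ×ˢ (univ : Set ℝ³), F z < δ := by
  set μF : Measure (ℝ × ℝ³) := (volume : Measure (ℝ × ℝ³)).withDensity F with hμF
  set s : ℕ → Set (ℝ × ℝ³) := fun n => Ioo (T - T / ((n : ℝ) + 1)) T ×ˢ (univ : Set ℝ³) with hs
  have hsm : ∀ n, MeasurableSet (s n) := fun n => measurableSet_Ioo.prod MeasurableSet.univ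
  have hanti : Antitone s := by
    intro m n hmn
    refine prod_mono (Ioo_subset_Ioo_left ?_) subset_rfl
    have h1 : (m : ℝ) + 1 ≤ n + 1 := by exact_mod_cast Nat.succ_le_succ hmn
    have h2 : T / ((n : ℝ) + 1) ≤ T / ((m : ℝ) + 1) :=
      div_le_div_of_nonneg_left hT.le (by positivity) h1
    linarith
  have hinter : ⋂ n, s n = ∅ := by
    ext z
    simp only [mem_iInter, mem_empty_iff_false, iff_false]
    intro hz
    have hpos : 0 < T - z.1 := by linarith [(hz 0).1.2]
    obtain ⟨n, hn⟩ := exists_nat_ge (T / (T - z.1))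
    have h4 : T < ((n : ℝ) + 1) * (T - z.1) := by
      rw [← div_lt_iff₀ hpos]; linarith
    have h5 : T / ((n : ℝ) + 1) < T - z.1 := by
      rw [div_lt_iff₀ (by positivity)]; linarith
    linarith [(hz n).1.1]
  have hfin : μF (s 0) ≠ ∞ := by
    rw [hμF, withDensity_apply _ (hsm 0)]
    exact ne_top_of_le_ne_top hF (setLIntegral_le_lintegral _ _)
  have htend := tendsto_measure_iInter_atTop (μ := μF) (fun n => (hsm n).nullMeasurableSet)
    hanti ⟨0, hfin⟩
  rw [hinter, measure_empty] at htend
  obtain ⟨n, hn⟩ := ((tendsto_order.1 htend).2 δ hδ).exists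
  refine ⟨T / ((n : ℝ) + 1), by positivity,
    div_le_self hT.le (by linarith [n.cast_nonneg (α := ℝ)]), ?_⟩
  have hn' : μF (s n) < δ := hn
  rwa [hμF, withDensity_apply _ (hsm n)] at hn'

/-- **Rotation invariance of the cut-off dissipation density.** If the slices `u t`, `t ∈ I`,
are axisymmetric, then `F = 𝟙_{I × B(0, ϱ)} |∇u|²` satisfies `F(t, R_θ x) = F(t, x)` everywhere
(`norm_rotZ`, `IsAxisymmetric.frobeniusNormSq_fderiv_rotZ`). -/
theorem indicator_frobeniusNormSq_fderiv_rotZ {u : ℝ → ℝ³ → ℝ³} {I : Set ℝ}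
    (hax : ∀ t ∈ I, IsAxisymmetric (u t)) (ϱ θ : ℝ) (z : ℝ × ℝ³) :
    (I ×ˢ ball (0 : ℝ³) ϱ).indicator
        (fun w : ℝ × ℝ³ => ENNReal.ofReal (frobeniusNormSq (fderiv ℝ (u w.1) w.2)))
        (z.1, rotZ θ z.2) =
      (I ×ˢ ball (0 : ℝ³) ϱ).indicator
        (fun w : ℝ × ℝ³ => ENNReal.ofReal (frobeniusNormSq (fderiv ℝ (u w.1) w.2))) z := by
  have hmem : ((z.1, rotZ θ z.2) : ℝ × ℝ³) ∈ I ×ˢ ball (0 : ℝ³) ϱ ↔ z ∈ I ×ˢ ball (0 : ℝ³) ϱ := by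
    simp only [mem_prod, mem_ball_zero_iff, norm_rotZ]
  by_cases hz : z ∈ I ×ˢ ball (0 : ℝ³) ϱ
  · rw [indicator_of_mem (hmem.2 hz), indicator_of_mem hz]
    show ENNReal.ofReal (frobeniusNormSq (fderiv ℝ (u z.1) (rotZ θ z.2))) =
      ENNReal.ofReal (frobeniusNormSq (fderiv ℝ (u z.1) z.2))
    rw [(hax z.1 hz.1).frobeniusNormSq_fderiv_rotZ θ z.2]
  · rw [indicator_of_notMem (fun h => hz (hmem.1 h)), indicator_of_notMem hz]

/-! ### Off the axis the final time is regular -/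

/-- **Off-axis points are regular at the final time** for a smooth axisymmetric suitable weak
solution below `T` whose local energy classes reach `T` (rotation packing of the cut-off
dissipation, viscosity-normalising rescaling about `(T, x₀)`, Seregin's backward ε-regularity
criterion `seregin2014_thm14_holds`; module docstring).  Seregin–Šverák 2009, §3 (arXiv p. 9);
Seregin 2020, proof of Thm. 2.1 (arXiv p. 5); Seregin 2014, Ch. 6, Thm. 1.4. -/
theorem offAxisBounded_of_localEnergy {ν T : ℝ} (hν : 0 < ν) (hT : 0 < T) {u : ℝ → ℝ³ → ℝ³}
    {p : ℝ → ℝ³ → ℝ} (hsm : ContDiffOn ℝ (⊤ : ℕ∞) (uncurry u) (Ioo 0 T ×ˢ univ))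
    (hax : ∀ t ∈ Ioo 0 T, IsAxisymmetric (u t))
    (hsw : IsSuitableWeakSolutionOn (slab ℝ³ (Ioo 0 T) isOpen_Ioo) ν 0 u p)
    (hloc : ∀ t₁ ∈ Ioo 0 T, ∀ ρ : ℝ, 0 < ρ →
      (∃ C : ℝ≥0, ∀ t ∈ Ioo t₁ T, ∫⁻ x in ball (0 : ℝ³) ρ, ‖u t x‖ₑ ^ 2 ≤ C) ∧
      (∫⁻ z in Ioo t₁ T ×ˢ ball (0 : ℝ³) ρ,
          ENNReal.ofReal (frobeniusNormSq (fderiv ℝ (u z.1) z.2)) < ∞) ∧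
      (∫⁻ z in Ioo t₁ T ×ˢ ball (0 : ℝ³) ρ, ‖p z.1 z.2‖ₑ ^ (3 / 2 : ℝ) < ∞))
    (x₀ : ℝ³) (hx₀ : cylRadius x₀ ≠ 0) : IsBoundedNearTop u T x₀ := by
  obtain ⟨ε, hε, hcrit⟩ := seregin2014_thm14_holds
  have hρ₀ : 0 < cylRadius x₀ := lt_of_le_of_ne (cylRadius_nonneg x₀) (Ne.symm hx₀)
  -- ### the local energy classes on `(T/2, T) × B(0, ϱ)`, `ϱ = ‖x₀‖ + ρ₀`
  set ϱ : ℝ := ‖x₀‖ + cylRadius x₀ with hϱ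
  obtain ⟨⟨C, hC⟩, hE, hP⟩ := hloc (T / 2) ⟨by linarith, by linarith⟩ ϱ (by positivity)
  have hballϱ : ∀ s : ℝ, s ≤ cylRadius x₀ → ball x₀ s ⊆ ball (0 : ℝ³) ϱ := by
    intro s hs x hx
    rw [mem_ball, dist_eq_norm] at hx
    rw [mem_ball_zero_iff, ← sub_add_cancel x x₀]
    exact (norm_add_le _ _).trans_lt (by rw [hϱ]; linarith)
  have hhalf : Ioo (T / 2) T ×ˢ ball (0 : ℝ³) ϱ ⊆ Ioo 0 T ×ˢ (univ : Set ℝ³) :=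
    prod_mono (Ioo_subset_Ioo_left (by linarith)) (subset_univ _)
  -- ### the cut-off dissipation density: rotation invariant, of finite integral, small tails
  set F : ℝ × ℝ³ → ℝ≥0∞ := (Ioo (T / 2) T ×ˢ ball (0 : ℝ³) ϱ).indicator
    (fun w : ℝ × ℝ³ => ENNReal.ofReal (frobeniusNormSq (fderiv ℝ (u w.1) w.2))) with hF
  have hFrot : ∀ θ : ℝ, (fun z : ℝ × ℝ³ => F (z.1, rotZ θ z.2)) =ᵐ[volume] F := fun θ =>
    Eventually.of_forall fun z => indicator_frobeniusNormSq_fderiv_rotZ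
      (fun t ht => hax t (Ioo_subset_Ioo_left (by linarith) ht)) ϱ θ z
  have hFint : ∫⁻ z, F z ≠ ∞ := by
    rw [hF, lintegral_indicator (measurableSet_Ioo.prod measurableSet_ball)]
    exact hE.ne
  obtain ⟨τ₀, hτ₀, -, hDτ₀⟩ := exists_time_tail_lt_of_lintegral_ne_top hFint hT
    (δ := ENNReal.ofReal (ε * ν * cylRadius x₀)) (ENNReal.ofReal_pos.2 (by positivity))
  -- ### scales: `0 < R ≤ ρ₀`, `R²/ν ≤ τ₀`, `R²/ν ≤ T/4`; `α = R/ν`, `β = R²/ν`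
  set R : ℝ := min (Real.sqrt (ν * T) / 2) (min (cylRadius x₀) (Real.sqrt (ν * τ₀))) with hR
  have hRpos : 0 < R := lt_min (by positivity) (lt_min hρ₀ (Real.sqrt_pos.2 (by positivity)))
  have hRρ₀ : R ≤ cylRadius x₀ := (min_le_right _ _).trans (min_le_left _ _)
  have hRτ : R ^ 2 / ν ≤ τ₀ := by
    have h2 := pow_le_pow_left₀ hRpos.le ((min_le_right _ _).trans (min_le_right _ _)) 2
    rw [Real.sq_sqrt (by positivity)] at h2
    rw [div_le_iff₀ hν]
    linarith
  have hRT : R ^ 2 / ν ≤ T / 4 := by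
    have h2 := pow_le_pow_left₀ hRpos.le (min_le_left _ _ : R ≤ Real.sqrt (ν * T) / 2) 2
    rw [div_pow, Real.sq_sqrt (by positivity)] at h2
    rw [div_le_iff₀ hν]
    linarith
  set α : ℝ := R / ν with hα
  set β : ℝ := R ^ 2 / ν with hβdef
  have hαpos : 0 < α := by positivity
  have hβpos : 0 < β := by positivity
  have hβeq : β = α * R := by rw [hβdef, hα]; field_simp
  -- the `ν`-cylinders `(T - (Rr)²/ν, T) × B(x₀, Rr)`, `0 < r ≤ 1`: in `(T/2,T) × B(0,ϱ)`; `Φ⁻¹`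
  have hνcylT : ∀ r : ℝ, 0 < r → r ≤ 1 → (R * r) ^ 2 / ν ≤ T / 4 := fun r hr hr1 =>
    le_trans (div_le_div_of_nonneg_right
      (pow_le_pow_left₀ (by positivity) (mul_le_of_le_one_right hRpos.le hr1) 2) hν.le) hRT
  have hνcyl : ∀ r : ℝ, 0 < r → r ≤ 1 →
      Ioo (T - (R * r) ^ 2 / ν) T ×ˢ ball x₀ (R * r) ⊆ Ioo (T / 2) T ×ˢ ball (0 : ℝ³) ϱ := by
    intro r hr hr1
    have h1 := hνcylT r hr hr1
    exact prod_mono (Ioo_subset_Ioo_left (by linarith))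
      (hballϱ _ ((mul_le_of_le_one_right hRpos.le hr1).trans hRρ₀))
  have hpreim : ∀ r : ℝ, parabolicCylinder r (0 : ℝ × ℝ³) =
      stAffine β R T x₀ ⁻¹' (Ioo (T - (R * r) ^ 2 / ν) T ×ˢ ball x₀ (R * r)) := fun r => by
    rw [hβdef, stAffine_preimage_cylinder_eq_parabolicCylinder hν hRpos T x₀ (R * r),
      mul_div_cancel_left₀ r hRpos.ne']
    rfl
  set PO : Opens (ℝ × ℝ³) := ⟨Ioo (T - β) T ×ˢ ball x₀ R, isOpen_Ioo.prod isOpen_ball⟩ with hPO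
  have hPOsub : (PO : Set (ℝ × ℝ³)) ⊆ Ioo (T / 2) T ×ˢ ball (0 : ℝ³) ϱ := by
    have := hνcyl 1 one_pos le_rfl
    rw [mul_one] at this
    exact this
  have hPOslab : (PO : Set (ℝ × ℝ³)) ⊆ Ioo 0 T ×ˢ (univ : Set ℝ³) := hPOsub.trans hhalf
  have hPOle : PO ≤ slab ℝ³ (Ioo 0 T) isOpen_Ioo := fun z hz => hPOslab hz
  -- ### `Φ⁻¹(PO) = Q(0, 1)` and the rescaled pair
  have hpre1 : stPreimage β R T x₀ PO = parabolicCylinderOpens 1 (0 : ℝ × ℝ³) := by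
    apply Opens.ext
    rw [coe_stPreimage]
    have h := stAffine_preimage_cylinder_eq_parabolicCylinder hν hRpos T x₀ R
    rw [div_self hRpos.ne'] at h
    exact h
  have hsuit1 : IsSuitableWeakSolutionOn (parabolicCylinderOpens 1 (0 : ℝ × ℝ³)) 1 0
      (α • stPull β R T x₀ u) (α ^ 2 • stPull β R T x₀ p) := by
    have h0 := (hsw.of_le hPOle).stRescale hαpos hRpos hβeq T x₀
    have hvisc : α * ν / R = 1 := by
      rw [hα, div_mul_cancel₀ R hν.ne', div_self hRpos.ne']
    have hforce : ((α ^ 2 * R) • stPull β R T x₀ (0 : ℝ → ℝ³ → ℝ³)) = 0 := by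
      funext s y; simp [stPull]
    rw [hvisc, hforce, hpre1] at h0
    exact h0
  -- the rescaled classical gradient and its dissipation on `Q(0, r)`
  have hGu : HasWeakSpatialGradientOn PO u fun t x => fderiv ℝ (u t) x :=
    hasWeakSpatialGradientOn_of_contDiffOn isOpen_Ioo hPOslab (hsm.of_le (by norm_cast))
  have hGv : HasWeakSpatialGradientOn (parabolicCylinderOpens 1 (0 : ℝ × ℝ³))
      (α • stPull β R T x₀ u) ((α * R) • stPull β R T x₀ fun t x => fderiv ℝ (u t) x) := by
    rw [← hpre1]
    exact hGu.stRescale α hβpos hRpos T x₀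
  have hEr : ∀ r : ℝ, 0 < r →
      ∫⁻ z in parabolicCylinder r (0 : ℝ × ℝ³), ENNReal.ofReal (frobeniusNormSq
          (((α * R) • stPull β R T x₀ fun t x => fderiv ℝ (u t) x) z.1 z.2)) =
        ENNReal.ofReal ((α * R) ^ 2) * ENNReal.ofReal (β * R ^ 3)⁻¹ *
          ∫⁻ z in Ioo (T - (R * r) ^ 2 / ν) T ×ˢ ball x₀ (R * r),
            ENNReal.ofReal (frobeniusNormSq (fderiv ℝ (u z.1) z.2)) := by
    intro r hr
    rw [hpreim r, setLIntegral_frobeniusNormSq_stRescale hβpos hRpos T x₀ (α * R),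
      finrank_euclideanSpace_fin]
  -- ### `E(r) ≤ D(τ₀) / (ν ρ₀)` for `0 < r < 1`, by the rotation packing of `F`
  have hcknE : ∀ r ∈ Ioo (0 : ℝ) 1,
      cknE r (0 : ℝ × ℝ³) ((α * R) • stPull β R T x₀ fun t x => fderiv ℝ (u t) x) ≤
        ENNReal.ofReal (ν * cylRadius x₀)⁻¹ *
          ∫⁻ z in Ioo (T - τ₀) T ×ˢ (univ : Set ℝ³), F z := by
    intro r hr
    have hr0 : 0 < r := hr.1
    have hRr : 0 < R * r := mul_pos hRpos hr0
    have hRrR : R * r ≤ R := mul_le_of_le_one_right hRpos.le hr.2.le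
    have hτ : (R * r) ^ 2 / ν ≤ τ₀ :=
      le_trans (div_le_div_of_nonneg_right (pow_le_pow_left₀ hRr.le hRrR 2) hν.le) hRτ
    have e1 : ∫⁻ z in Ioo (T - (R * r) ^ 2 / ν) T ×ˢ ball x₀ (R * r),
          ENNReal.ofReal (frobeniusNormSq (fderiv ℝ (u z.1) z.2)) =
        ∫⁻ z in Ioo (T - (R * r) ^ 2 / ν) T ×ˢ ball x₀ (R * r), F z := by
      refine setLIntegral_congr_fun (measurableSet_Ioo.prod measurableSet_ball) fun q hq => ?_
      rw [hF, indicator_of_mem (hνcyl r hr0 hr.2.le hq)]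
    have hpack := setLIntegral_prod_ball_le_of_rot_invariant hFrot hρ₀ hRr (hRrR.trans hRρ₀)
      (measurableSet_Ioo (a := T - (R * r) ^ 2 / ν) (b := T))
    have hmono : ∫⁻ z in Ioo (T - (R * r) ^ 2 / ν) T ×ˢ (univ : Set ℝ³), F z ≤
        ∫⁻ z in Ioo (T - τ₀) T ×ˢ (univ : Set ℝ³), F z :=
      lintegral_mono_set (prod_mono (Ioo_subset_Ioo_left (by linarith)) subset_rfl)
    unfold cknE
    rw [hEr r hr0, e1]
    have key : (ENNReal.ofReal r)⁻¹ * (ENNReal.ofReal ((α * R) ^ 2) * ENNReal.ofReal (β * R ^ 3)⁻¹ *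
        (ENNReal.ofReal (R * r / cylRadius x₀) *
          ∫⁻ z in Ioo (T - τ₀) T ×ˢ (univ : Set ℝ³), F z)) =
        ENNReal.ofReal (ν * cylRadius x₀)⁻¹ *
          ∫⁻ z in Ioo (T - τ₀) T ×ˢ (univ : Set ℝ³), F z := by
      rw [← ENNReal.ofReal_inv_of_pos hr0, ← mul_assoc, ← mul_assoc, ← mul_assoc,
        ← ENNReal.ofReal_mul (inv_nonneg.2 hr0.le),
        ← ENNReal.ofReal_mul (by positivity : (0 : ℝ) ≤ r⁻¹ * (α * R) ^ 2),
        ← ENNReal.ofReal_mul (by positivity : (0 : ℝ) ≤ r⁻¹ * (α * R) ^ 2 * (β * R ^ 3)⁻¹)]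
      congr 2
      rw [hα, hβdef]
      field_simp
    rw [← key]
    gcongr
    exact hpack.trans (mul_le_mul' le_rfl hmono)
  -- ### the rescaled pair in the class `IsSuitableWeakSolutionInBall 1 0`
  have hball : IsSuitableWeakSolutionInBall 1 0 (α • stPull β R T x₀ u)
      (α ^ 2 • stPull β R T x₀ p) := by
    refine ⟨hsuit1, ?_, ⟨_, hGv, ?_⟩, ?_⟩
    · -- energy class from the local energy bound on `(T/2, T) × B(0, ϱ)`
      have hphys : ∀ᵐ t ∂(volume.restrict (Ioo (T + β * (-1)) (T + β * 0))),
          ∫⁻ x in ball x₀ R, ‖u t x‖ₑ ^ 2 ≤ (C : ℝ≥0∞) := by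
        refine (ae_restrict_mem measurableSet_Ioo).mono fun t ht => ?_
        have htI : t ∈ Ioo (T / 2) T := ⟨by linarith [ht.1], by simpa using ht.2⟩
        exact (lintegral_mono_set (hballϱ R hRρ₀)).trans (hC t htI)
      have h2 := ae_sliced_setLIntegral_ball_stRescale hβpos hRpos T x₀ x₀ R (-1) 0
        (fun t x => ‖u t x‖ₑ ^ 2) hphys
      rw [finrank_euclideanSpace_fin, sub_self, smul_zero, div_self hRpos.ne'] at h2
      set C₁ : ℝ≥0∞ := ‖α‖ₑ ^ 2 * (ENNReal.ofReal (R ^ 3)⁻¹ * C) with hC₁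
      have hC₁top : C₁ ≠ ∞ :=
        ENNReal.mul_ne_top (by simp) (ENNReal.mul_ne_top ENNReal.ofReal_ne_top ENNReal.coe_ne_top)
      refine ⟨C₁.toNNReal, ?_⟩
      rw [ENNReal.coe_toNNReal hC₁top]
      have hset : Ioo ((0 : ℝ × ℝ³).1 - 1 ^ 2) (0 : ℝ × ℝ³).1 = Ioo (-1 : ℝ) 0 := by simp
      rw [hset]
      filter_upwards [h2] with s hs
      have e : ∀ y : ℝ³, ‖(α • stPull β R T x₀ u) s y‖ₑ ^ 2 =
          ‖α‖ₑ ^ 2 * ‖u (T + β * s) (x₀ + R • y)‖ₑ ^ 2 := by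
        intro y
        rw [smul_stPull_apply, enorm_smul, mul_pow]
      simp only [e]
      rw [lintegral_const_mul' _ _ (by simp)]
      exact mul_le_mul' le_rfl hs
    · -- `∫_{Q(0,1)} |∇v|² < ∞`
      rw [hEr 1 one_pos]
      refine ENNReal.mul_lt_top (ENNReal.mul_lt_top ENNReal.ofReal_lt_top ENNReal.ofReal_lt_top) ?_
      exact lt_of_le_of_lt (lintegral_mono_set (hνcyl 1 one_pos le_rfl)) hE
    · -- `π ∈ L^{3/2}(Q(0,1))`
      refine ⟨hsuit1.distributional.2.2.1.aestronglyMeasurable, ?_⟩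
      have h32 : ((3 : ℝ≥0∞) / 2).toReal = 3 / 2 := by
        rw [ENNReal.toReal_div]; norm_num
      have h32top : (3 : ℝ≥0∞) / 2 ≠ ∞ := (ENNReal.div_lt_top (by simp) (by simp)).ne
      rw [eLpNorm_eq_lintegral_rpow_enorm_toReal (by norm_num) h32top, h32]
      refine ENNReal.rpow_lt_top_of_nonneg (by positivity) (ne_of_lt ?_)
      have hQ1 : parabolicCylinder 1 (0 : ℝ × ℝ³) = stAffine β R T x₀ ⁻¹' (PO : Set (ℝ × ℝ³)) := by
        rw [← coe_stPreimage, hpre1]; rfl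
      rw [hQ1]
      show ∫⁻ z in stAffine β R T x₀ ⁻¹' (PO : Set (ℝ × ℝ³)),
          ‖(α ^ 2 • stPull β R T x₀ p) z.1 z.2‖ₑ ^ (3 / 2 : ℝ) < ∞
      rw [setLIntegral_enorm_rpow_stRescale hβpos hRpos T x₀ (α ^ 2) p _ (by norm_num)]
      refine ENNReal.mul_lt_top (ENNReal.mul_lt_top
        (ENNReal.rpow_lt_top_of_nonneg (by norm_num) enorm_ne_top) ENNReal.ofReal_lt_top) ?_
      exact lt_of_le_of_lt (lintegral_mono_set hPOsub) hP
  -- ### smallness of the multi-scale dissipation and Seregin's criterion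
  have hsmall : (⨆ r ∈ Ioo (0 : ℝ) 1,
      cknE r (0 : ℝ × ℝ³) ((α * R) • stPull β R T x₀ fun t x => fderiv ℝ (u t) x)) <
        ENNReal.ofReal ε := by
    refine lt_of_le_of_lt (iSup₂_le fun r hr => hcknE r hr) ?_
    have hc0 : ENNReal.ofReal (ν * cylRadius x₀)⁻¹ ≠ 0 :=
      (ENNReal.ofReal_pos.2 (by positivity)).ne'
    calc ENNReal.ofReal (ν * cylRadius x₀)⁻¹ * ∫⁻ z in Ioo (T - τ₀) T ×ˢ (univ : Set ℝ³), F z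
        < ENNReal.ofReal (ν * cylRadius x₀)⁻¹ * ENNReal.ofReal (ε * ν * cylRadius x₀) := by
          have := ENNReal.mul_lt_mul_left hc0 ENNReal.ofReal_ne_top hDτ₀
          simpa only [mul_comm] using this
      _ = ENNReal.ofReal ε := by
          rw [← ENNReal.ofReal_mul (by positivity)]
          congr 1
          field_simp
  obtain ⟨ϱ', hϱ', hbd⟩ := hcrit _ _ hball ⟨_, hGv, hsmall⟩
  -- ### back to `u`: `Q(0, ϱ') = Φ⁻¹((T - (Rϱ')²/ν, T) × B(x₀, Rϱ'))`, essential suprema are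
  -- `Φ`-invariant, and an essential bound of the continuous `u` below `T` is a bound
  rw [hpreim ϱ', show uncurry (α • stPull β R T x₀ u) = α • (uncurry u ∘ stAffine β R T x₀) from
    rfl, eLpNorm_const_smul, eLpNorm_top_comp_stAffine_restrict_preimage hβpos hRpos] at hbd
  exact isBoundedNearTop_of_eLpNorm_cylinder_lt_top hsm.continuousOn
    (div_pos (pow_pos (mul_pos hRpos hϱ'.1) 2) hν)
    ((hνcylT ϱ' hϱ'.1 hϱ'.2.le).trans (by linarith)) (mul_pos hRpos hϱ'.1)
    (ENNReal.lt_top_of_mul_ne_top_right hbd.ne (by simp [hαpos.ne']))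

/-! ### The registered stub -/

/-- **Registered stub 2b' `stub_offAxisBounded_of_localEnergy`** of the line `registered` of the
crux `AxisymmetricKatoGlobal` (stmt-NavierStokesRegularity-15453), verbatim: for a suitable weak
solution `(u, p)` of the unforced equations (viscosity `ν > 0`) on the open strip `(0, T) × ℝ³`,
`u` smooth there with axisymmetric slices, whose local energy classes reach the final time on
every `(t₁, T) × B_ρ(0)`, `u` is bounded near `(T, x₀)` for every `x₀` off the axis
(`offAxisBounded_of_localEnergy`; Seregin–Šverák 2009, §3; Seregin 2020, proof of Thm. 2.1). -/
theorem stub_offAxisBounded_of_localEnergy :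
    ∀ ν : ℝ, 0 < ν → ∀ T : ℝ, 0 < T → ∀ (u : ℝ → ℝ³ → ℝ³) (p : ℝ → ℝ³ → ℝ),
      ContDiffOn ℝ (⊤ : ℕ∞) (uncurry u) (Ioo 0 T ×ˢ univ) →
      (∀ t ∈ Ioo 0 T, IsAxisymmetric (u t)) →
      IsSuitableWeakSolutionOn (slab ℝ³ (Ioo 0 T) isOpen_Ioo) ν 0 u p →
      (∀ t₁ ∈ Ioo 0 T, ∀ ρ : ℝ, 0 < ρ →
          (∃ C : ℝ≥0, ∀ t ∈ Ioo t₁ T, ∫⁻ x in ball (0 : ℝ³) ρ, ‖u t x‖ₑ ^ 2 ≤ C) ∧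
          (∫⁻ z in Ioo t₁ T ×ˢ ball (0 : ℝ³) ρ,
              ENNReal.ofReal (frobeniusNormSq (fderiv ℝ (u z.1) z.2)) < ∞) ∧
          (∫⁻ z in Ioo t₁ T ×ˢ ball (0 : ℝ³) ρ, ‖p z.1 z.2‖ₑ ^ (3 / 2 : ℝ) < ∞)) →
      ∀ x₀ : ℝ³, cylRadius x₀ ≠ 0 → IsBoundedNearTop u T x₀ :=
  fun _ν hν _T hT _u _p hsm hax hsw hloc x₀ hx₀ =>
    offAxisBounded_of_localEnergy hν hT hsm hax hsw hloc x₀ hx₀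

end Summit.NavierStokesRegularity.NavierStokesRegularity.Theorems.AxisymmetricKatoGlobal.Registered

end
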